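import Summits.ValiantsHypothesis.ValiantsHypothesis.Theorems.LacunarySymmetroidMatrixDescartesCensusChamberSignClass
import Summits.ValiantsHypothesis.ValiantsHypothesis.Theorems.LacunarySymmetroidMatrixDescartesCensusMirror

/-!
# `MatrixDescartes` census — symmetries of CHAMBER ROWS: letter relabelling and the mirror `d ↦ N − d`

HONEST FRAMING.  Object-search cell `pub-symmetroid`, door-A target `DoorA26 := PosRootLawAt 2 6 19`
(stmt-ValiantsHypothesis-19979; OPEN, typed, never asserted), crux `Theses.LacunarySymmetroid.MatrixDescartes`
(stmt-ValiantsHypothesis-18050).  A CHAMBER ROW is the statement «`PosRootLawOn 2 6 19 d` for every exponent vector `d`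
whose 21 pair sums increase along the order `σ : Fin 21 → Fin 6 × Fin 6`» (…CensusChamberSignClass.lean;
`Census.doorA26_iff_forall_chamberOrder` reduces door A to these rows).  Two symmetries cut the list of rows to prove:

* `chamberRow_relabel` — relabelling the six letters by a permutation `π` (order `t ↦ (π (σ t).1, π (σ t).2)`) preserves the
  row (tree: `posRootLawOn_comp_equiv_iff`); so rows may be stated for sorted supports only;
* `chamberRow_mirror` — the MIRROR order `t ↦ ((σ (rev t)).2.rev, (σ (rev t)).1.rev)` (reverse the order and relabel
  `i ↦ 5 − i`; this is theory g6's `mirror` column, `d ↦ d₅ − d_{5−i}` on sorted supports) inherits the row (tree: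
  `posRootLawOn_iff_mirror_rev`, the substitution `x ↦ 1/x`); so of the cell's 2 608 chambers (1 304 mirror pairs, no
  self-mirror chamber) only one per pair needs a certificate;
* `coversPairs_relabel`, `coversPairs_mirror` — the covering side condition transfers as well.

Bookkeeping only: nothing here proves any particular row, and nothing bears on `V = 19`, on `DoorA26` (OPEN), on the
crux, or on `VP ≠ VNP`.

[folklore] Elementary; no citation exists or is needed.
-/

-- `Summit.ValiantsHypothesis.ValiantsHypothesis.…` repeats a component by the D-0017 layout
-- (single-conjunct summit), which the `dupNamespace` linter flags; the name is mandated.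
set_option linter.dupNamespace false

namespace Summit.ValiantsHypothesis.ValiantsHypothesis.Theorems.LacunarySymmetroidMatrixDescartes.Census

open Polynomial Finset
open scoped BigOperators Polynomial Matrix

/-! ## Relabelling the letters -/

/-- The covering condition is invariant under relabelling the letters. [folklore] -/
theorem coversPairs_relabel (σ : Fin 21 → Fin 6 × Fin 6) (π : Equiv.Perm (Fin 6))
    (hcov : ∀ p : Fin 6 × Fin 6, ∃ t : Fin 21, σ t = p ∨ σ t = p.swap) :
    ∀ p : Fin 6 × Fin 6, ∃ t : Fin 21,
      (fun t => (π (σ t).1, π (σ t).2)) t = p ∨ (fun t => (π (σ t).1, π (σ t).2)) t = p.swap := by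
  intro p
  obtain ⟨t, ht | ht⟩ := hcov (π.symm p.1, π.symm p.2)
  · exact ⟨t, Or.inl (by simp only [ht, Equiv.apply_symm_apply])⟩
  · exact ⟨t, Or.inr (by simp only [ht, Prod.swap_prod_mk, Equiv.apply_symm_apply]; rfl)⟩

/-- **Chamber rows are invariant under relabelling the letters**: if the row holds for the order `σ`, it holds for the
order `t ↦ (π (σ t).1, π (σ t).2)` — an exponent vector `d` lies in the relabelled chamber iff `d ∘ π` lies in the
chamber of `σ`, and `ζ(2,6; d) = ζ(2,6; d ∘ π)`. [folklore] -/
theorem chamberRow_relabel (σ : Fin 21 → Fin 6 × Fin 6) (π : Equiv.Perm (Fin 6))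
    (hrow : ∀ d : Fin 6 → ℕ, StrictMono ((fun p : Fin 6 × Fin 6 => d p.1 + d p.2) ∘ σ) → PosRootLawOn 2 6 19 d)
    (d : Fin 6 → ℕ)
    (hd : StrictMono ((fun p : Fin 6 × Fin 6 => d p.1 + d p.2) ∘ (fun t => (π (σ t).1, π (σ t).2)))) :
    PosRootLawOn 2 6 19 d := by
  have hmono : StrictMono ((fun p : Fin 6 × Fin 6 => (d ∘ π) p.1 + (d ∘ π) p.2) ∘ σ) := by
    intro s s' hss'
    exact hd hss'
  exact (posRootLawOn_comp_equiv_iff π d).mpr (hrow (d ∘ π) hmono)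

/-! ## The mirror -/

/-- The covering condition transfers to the mirror order. [folklore] -/
theorem coversPairs_mirror (σ : Fin 21 → Fin 6 × Fin 6)
    (hcov : ∀ p : Fin 6 × Fin 6, ∃ t : Fin 21, σ t = p ∨ σ t = p.swap) :
    ∀ p : Fin 6 × Fin 6, ∃ t : Fin 21,
      (fun t => ((σ (Fin.rev t)).2.rev, (σ (Fin.rev t)).1.rev)) t = p ∨
        (fun t => ((σ (Fin.rev t)).2.rev, (σ (Fin.rev t)).1.rev)) t = p.swap := by
  intro p
  obtain ⟨t, ht | ht⟩ := hcov (p.2.rev, p.1.rev)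
  · exact ⟨Fin.rev t, Or.inl (by simp only [Fin.rev_rev, ht])⟩
  · exact ⟨Fin.rev t, Or.inr (by simp only [Fin.rev_rev, ht, Prod.swap_prod_mk]; rfl)⟩

/-- **Chamber rows transfer to the MIRROR chamber.**  If the row holds for the order `σ`, it holds for the mirror order
`t ↦ ((σ (rev t)).2.rev, (σ (rev t)).1.rev)`: for `d` in the mirror chamber, the support `l ↦ N − d (5 − l)`
(`N = max d`) lies in the chamber of `σ`, and the two supports carry the same positive-root counts (`x ↦ 1/x`,
`posRootLawOn_iff_mirror_rev`). [folklore] -/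
theorem chamberRow_mirror (σ : Fin 21 → Fin 6 × Fin 6)
    (hrow : ∀ d : Fin 6 → ℕ, StrictMono ((fun p : Fin 6 × Fin 6 => d p.1 + d p.2) ∘ σ) → PosRootLawOn 2 6 19 d)
    (d : Fin 6 → ℕ)
    (hd : StrictMono ((fun p : Fin 6 × Fin 6 => d p.1 + d p.2) ∘
      (fun t => ((σ (Fin.rev t)).2.rev, (σ (Fin.rev t)).1.rev)))) :
    PosRootLawOn 2 6 19 d := by
  set N := (univ : Finset (Fin 6)).sup d with hN
  have hle : ∀ l, d l ≤ N := fun l => Finset.le_sup (f := d) (mem_univ l)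
  have hmono : StrictMono ((fun p : Fin 6 × Fin 6 => (fun l => N - d (Fin.rev l)) p.1 +
      (fun l => N - d (Fin.rev l)) p.2) ∘ σ) := by
    intro s s' hss'
    have h := hd (Fin.rev_lt_rev.mpr hss')
    simp only [Function.comp, Fin.rev_rev] at h ⊢
    have h1 := hle (σ s).1.rev
    have h2 := hle (σ s).2.rev
    have h3 := hle (σ s').1.rev
    have h4 := hle (σ s').2.rev
    omega
  exact (posRootLawOn_iff_mirror_rev d N hle).mpr (hrow _ hmono)

/-- **Mirror chambers, pointwise certificate form**: the row for `σ` on all of its chamber gives the row on any support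
whose REVERSED pair sums decrease along `σ` read through `i ↦ 5 − i` — the form in which a landed chamber theorem
`doorA26_on_chamber<id>` covers theory g6's mirror chamber without a second certificate. [folklore] -/
theorem chamberRow_mirror' (σ : Fin 21 → Fin 6 × Fin 6)
    (hrow : ∀ d : Fin 6 → ℕ, StrictMono ((fun p : Fin 6 × Fin 6 => d p.1 + d p.2) ∘ σ) → PosRootLawOn 2 6 19 d)
    (d : Fin 6 → ℕ)
    (hd : StrictAnti (fun t : Fin 21 => d (σ t).1.rev + d (σ t).2.rev)) :
    PosRootLawOn 2 6 19 d := by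
  refine chamberRow_mirror σ hrow d ?_
  intro s s' hss'
  have h := hd (Fin.rev_lt_rev.mpr hss')
  simp only [Function.comp] at h ⊢
  omega

end Summit.ValiantsHypothesis.ValiantsHypothesis.Theorems.LacunarySymmetroidMatrixDescartes.Census
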